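import Literature.AlgebraicGeometry.Resolution.BlowupsFlatBaseChange
import Literature.AlgebraicGeometry.Resolution.CompletedPullbackRegular
import Mathlib.RingTheory.AdicCompletion.AsTensorProduct
import Mathlib.AlgebraicGeometry.Morphisms.Flat
import HarnessLib

/-!
# Crux `PatchingRelPerfect` (stmt-ResolutionOfSingularities-16161), chain w52, task W4:
# blow-ups pull back to blow-ups along `Spec 𝒪_{N,n} → N` and along `Spec Ŝ → Spec S`

[OURS · L1 W5.2 · W4] The two base-change lemmas the planner's v4 proposal P0 ("blow-up form" of
the open core `stub_atomDimFour`) needs, in all dimensions.  Both are COROLLARIES of tree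
theorems and are recorded here only to give them citable names in the shape the line's engine
uses (`pullback.snd`, `Scheme.fromSpecStalk`, `specOfAlgebra S (AdicCompletion 𝔪 S)`):

* blow-ups commute with flat base change — `IsBlowup.of_isPullback_of_flat` /
  `IsBlowup.pullback_snd_of_flat` (Görtz–Wedhorn I, Prop. 13.91 (2); Stacks 0805), tree file
  `Literature/AlgebraicGeometry/Resolution/BlowupsFlatBaseChange.lean`;
* `Spec 𝒪_{N,n} ⟶ N` is flat — `flat_fromSpecStalk` (Stacks 01J7), same file;
* the `I`-adic completion of a Noetherian ring is flat — Mathlib's instance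
  `Module.Flat S (AdicCompletion I S)`.

Results: `isBlowup_pullback_snd_fromSpecStalk`, `isBlowup_of_isPullback_fromSpecStalk`
(W4 (a): for a blow-up `q : M ⟶ N` along `I` and `n : N`,
`M ×_N Spec 𝒪_{N,n} ⟶ Spec 𝒪_{N,n}` is a blow-up along `I 𝒪_{N,n}`), `flat_specOfAlgebra_of_flat`, `flat_specOfAlgebra_adicCompletion`,
`isBlowup_pullback_snd_specOfAlgebra_adicCompletion`, `isBlowup_of_isPullback_adicCompletion`
(W4 (b): for a blow-up `f : T ⟶ Spec S` along `J`, `S` Noetherian,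
`T ×_S Spec Ŝ ⟶ Spec Ŝ` is a blow-up along `J Ŝ`, `Ŝ` the `I`-adic completion for any ideal `I`).

## References

* U. Görtz, T. Wedhorn, *Algebraic Geometry I* (2nd ed., 2020), Prop. 13.91. [GortzWedhorn2020]
* The Stacks Project, Tags 0805, 01J7, 00MB (completion is flat). [StacksProject]
* M. Temkin, Adv. Math. 219 (2008), §2.1 (p. 6–7). [Temkin2008]
-/

-- `Summit.<Summit>.<Sub>.Theorems` with `Sub = Summit` (single-conjunct summit, D-0017)
set_option linter.dupNamespace false

noncomputable section

open CategoryTheory CategoryTheory.Limits AlgebraicGeometry Literature.AlgebraicGeometry.Resolution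

namespace Summit.ResolutionOfSingularities.ResolutionOfSingularities.Theorems

universe u

/-! ## (a) Base change to the local scheme `Spec 𝒪_{N,n}` -/

/-- **W4 (a).** If `q : M ⟶ N` is a blow-up along `I` and `n : N`, then the pro-open local scheme
`M ×_N Spec 𝒪_{N,n} ⟶ Spec 𝒪_{N,n}` (chosen pullback) is a blow-up along `I 𝒪_{N,n}`
(`I.comap (N.fromSpecStalk n)`): blow-ups commute with the flat base change
`Spec 𝒪_{N,n} ⟶ N`.
[cite: GortzWedhorn2020, Prop. 13.91 (2)] [cite: StacksProject, Tag 01J7] -/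
theorem isBlowup_pullback_snd_fromSpecStalk {M N : Scheme.{u}} {q : M ⟶ N}
    {I : N.IdealSheafData} (hq : IsBlowup q I) (n : N) :
    IsBlowup (pullback.snd q (N.fromSpecStalk n)) (I.comap (N.fromSpecStalk n)) := by
  haveI : Flat (N.fromSpecStalk n) := flat_fromSpecStalk N n
  exact hq.pullback_snd_of_flat _

/-- **W4 (a), for an arbitrary cartesian square** `fst ≫ q = snd ≫ N.fromSpecStalk n`:
`snd` is a blow-up along `I 𝒪_{N,n}`. [cite: GortzWedhorn2020, Prop. 13.91 (2)] -/
theorem isBlowup_of_isPullback_fromSpecStalk {P M N : Scheme.{u}} {q : M ⟶ N}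
    {I : N.IdealSheafData} (hq : IsBlowup q I) (n : N) {fst : P ⟶ M}
    {snd : P ⟶ Spec (N.presheaf.stalk n)} (H : IsPullback fst snd q (N.fromSpecStalk n)) :
    IsBlowup snd (I.comap (N.fromSpecStalk n)) := by
  haveI : Flat (N.fromSpecStalk n) := flat_fromSpecStalk N n
  exact hq.of_isPullback_of_flat H

/-! ## (b) Base change to the completion `Spec Ŝ` -/

/-- `Spec E ⟶ Spec D` is flat when `E` is a flat `D`-algebra. [folklore] -/
theorem flat_specOfAlgebra_of_flat (D E : Type u) [CommRing D] [CommRing E] [Algebra D E]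
    [Module.Flat D E] : Flat (specOfAlgebra D E) := by
  refine (HasRingHomProperty.Spec_iff (P := @Flat)).mpr ?_
  change (algebraMap D E).Flat
  exact RingHom.flat_algebraMap_iff.mpr inferInstance

/-- **The completion map `Spec Ŝ ⟶ Spec S` is flat** for `S` Noetherian and `Ŝ` the `I`-adic
completion along any ideal `I` (Stacks 00MB; Mathlib: `AdicCompletion I S` is a flat
`S`-module). [cite: StacksProject, Tag 00MB] -/
theorem flat_specOfAlgebra_adicCompletion (S : Type u) [CommRing S] [IsNoetherianRing S]
    (I : Ideal S) : Flat (specOfAlgebra S (AdicCompletion I S)) :=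
  flat_specOfAlgebra_of_flat S (AdicCompletion I S)

/-- **W4 (b).** If `f : T ⟶ Spec S` is a blow-up along `J` (`S` Noetherian) and `Ŝ` is the
`I`-adic completion of `S`, then `T ×_S Spec Ŝ ⟶ Spec Ŝ` (chosen pullback) is a blow-up along
`J Ŝ` (`J.comap (Spec Ŝ → Spec S)`). [cite: GortzWedhorn2020, Prop. 13.91 (2)]
[cite: StacksProject, Tag 00MB] -/
theorem isBlowup_pullback_snd_specOfAlgebra_adicCompletion {S : Type u} [CommRing S]
    [IsNoetherianRing S] (I : Ideal S) {T : Scheme.{u}} {f : T ⟶ Spec (.of S)}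
    {J : (Spec (.of S)).IdealSheafData} (hf : IsBlowup f J) :
    IsBlowup (pullback.snd f (specOfAlgebra S (AdicCompletion I S)))
      (J.comap (specOfAlgebra S (AdicCompletion I S))) := by
  haveI := flat_specOfAlgebra_adicCompletion S I
  exact hf.pullback_snd_of_flat _

/-- **W4 (b), for an arbitrary cartesian square** over `Spec Ŝ ⟶ Spec S`.
[cite: GortzWedhorn2020, Prop. 13.91 (2)] -/
theorem isBlowup_of_isPullback_adicCompletion {S : Type u} [CommRing S] [IsNoetherianRing S]
    (I : Ideal S) {P T : Scheme.{u}} {f : T ⟶ Spec (.of S)} {J : (Spec (.of S)).IdealSheafData}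
    (hf : IsBlowup f J) {fst : P ⟶ T} {snd : P ⟶ Spec (.of (AdicCompletion I S))}
    (H : IsPullback fst snd f (specOfAlgebra S (AdicCompletion I S))) :
    IsBlowup snd (J.comap (specOfAlgebra S (AdicCompletion I S))) := by
  haveI := flat_specOfAlgebra_adicCompletion S I
  exact hf.of_isPullback_of_flat H

/-- **Both steps at once** (the shape P0's closed step meets): for a blow-up `q : M ⟶ N` along
`I`, a point `n`, and — writing `S = 𝒪_{N,n}` (Noetherian) — the composite base change
`M ×_N Spec S ×_S Spec Ŝ ⟶ Spec Ŝ` is a blow-up along `I Ŝ`.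
[cite: GortzWedhorn2020, Prop. 13.91 (2)] -/
theorem isBlowup_pullback_snd_fromSpecStalk_adicCompletion {M N : Scheme.{u}} {q : M ⟶ N}
    {I : N.IdealSheafData} (hq : IsBlowup q I) (n : N)
    [IsNoetherianRing (N.presheaf.stalk n)] (𝔞 : Ideal (N.presheaf.stalk n)) :
    IsBlowup
      (pullback.snd (pullback.snd q (N.fromSpecStalk n))
        (specOfAlgebra (N.presheaf.stalk n) (AdicCompletion 𝔞 (N.presheaf.stalk n))))
      ((I.comap (N.fromSpecStalk n)).comap
        (specOfAlgebra (N.presheaf.stalk n) (AdicCompletion 𝔞 (N.presheaf.stalk n)))) :=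
  isBlowup_pullback_snd_specOfAlgebra_adicCompletion 𝔞 (isBlowup_pullback_snd_fromSpecStalk hq n)

end Summit.ResolutionOfSingularities.ResolutionOfSingularities.Theorems

end
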